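/-
Copyright (c) 2026 the pub-hodgecm-mathlib formalisation cell (harness21).  Prover seat hodgecm-mathlib-K2E3-p01 (g0), Track B ∕ K2-LIT
(build stream 29), h413 = `stmt-HodgeConjecture-24833`, line `K2_E3_EllipticInputs`, unit U3, line U3-d (lead K2E3-p03): FILE A of the ‹Ψ-package›
(DEAL SPEC K2/STATUS.md 2026-09-03T22:29:11Z) — part 1, the ring-level and ultrametric algebra of the Cayley scaling `Ψ = c ∘ (t²·) ∘ c⁻¹`.  2026-09-03.
-/
import Summits.HodgeConjecture.HodgeConjecture.Theorems.K2E3CompactCartanRegularRay   -- ★ p855173 (this seat): `separable_charpoly_cayley_iff`, `separable_charpoly_smul_iff`, `skew_smul_of_fixed`; brings ★ `cayley`, (Q3), `CayleyCharpolyDiscr`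
import Mathlib.Analysis.Normed.Group.Ultra
import HarnessLib

/-!
# h413 ∕ Track B «K2-LIT», line `K2_E3_EllipticInputs`, unit U3, line U3-d: THE ALGEBRA OF THE CAYLEY SCALING `Ψ = c ∘ (t²·) ∘ c⁻¹` (‹Ψ-package› FILE A, part 1)

Cell `pub/hodgecm-mathlib`, crux H413 = `stmt-HodgeConjecture-24833`, route of record `HCCMUnconditional`; chair K2-lead (g0), dealer K2E3-plan (g1), line lead of U3-d
K2E3-p03 (g0) (DEAL SPEC 22:29:11Z: FILE A `Theorems/K2E3CayleyScalingPackage.lean : ‹SC-explicit› → ‹Ψ-package›` with the explicit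
`Ψ γ := e⁻¹ c(t²·c⁻¹(e γ))` on an Ad-stable clopen ball `U₀`).  THEOREMS ONLY (no `def`, no `instance`, no `notation`, no named-fact hypothesis, no `sorry`);
imports = ★ Theorems∕Literature + Mathlib + HarnessLib; lane `--supports stmt-HodgeConjecture-24833 --as helper` (count-neutral).

THE MATHEMATICS ([PlatonovRapinchuk1994] §3.3: the Cayley parametrisation `c(X) = (1 + X)(1 − X)⁻¹`, its inverse `c⁻¹(g) = (g − 1)(g + 1)⁻¹` and their equivariance;
[HarishChandra1999] §3.1 Lemma 3.2: homogeneity under the scaling `X ↦ t²X`; [BasuPollackRoy2006] §4.2.2 (coefficients of the cubic characteristic polynomial)).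
This part holds what does not see the unitary group or the place: §1 over a commutative ring `R` (with `2 ∈ Rˣ` where needed) — `c⁻¹(c(X)) = X`
(`inverseWindow_cayley`), conjugation-equivariance of `A ↦ A⁻¹`, `c⁻¹` and `c` (`conj_nonsing_inv`, `inverseWindow_conj`, `cayley_conj`), the iterate
`c(t²·c⁻¹(c(Y))) = c(t²Y)` bookkeeping (`cayley_scaled_inverseWindow_cayley`), and for `3 × 3` matrices the coefficients of `χ_{t•M}` (`charpoly_coeff_smul_fin_three`)
and `det(1 + M) = 1 − c₂ + c₁ − c₀` (`det_one_add_fin_three`); §2 over an ULTRAMETRIC normed field `K` — the «eigenvalue ball» `‖c₂‖ ≤ ρ, ‖c₁‖ ≤ ρ², ‖c₀‖ ≤ ρ³`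
(`ρ < 1`; all eigenvalues of `M` of absolute value `≤ ρ`, stated on the coefficients so that no splitting field is needed) forces `‖det(1 ∓ M)‖ = 1`
(`norm_det_one_sub_eq_one`, `norm_det_one_add_eq_one`), and is preserved and CONTRACTED by `M ↦ t•M`, `‖t‖ ≤ 1` (`coeff_ball_smul`).
Part 2 (`K2E3CayleyScalingDefs`, the objects `Ψ`, `U₀`) and part 3 (`K2E3CayleyScalingPackage`, the properties (U1)–(S) and the head) follow.

HONEST LABEL.  HC_CM is proved only modulo the 7 printed citations (2 remaining named inputs: hLiu418 = `stmt-HodgeConjecture-24832`, h413 =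
`stmt-HodgeConjecture-24833`) until rung 0 closes; this file is a count-neutral algebra helper.

## References
* [PlatonovRapinchuk1994] V. Platonov, A. Rapinchuk, *Algebraic Groups and Number Theory* (1994), §3.3 (Cayley parametrisation of unitary groups).
* [HarishChandra1999AdmissibleDistributions] Harish-Chandra, *Admissible Invariant Distributions on Reductive p-adic Groups*, ULS 16 (1999), §3.1 Lemma 3.2.
* [BasuPollackRoy2006] S. Basu, R. Pollack, M.-F. Roy, *Algorithms in Real Algebraic Geometry*, 2nd ed. (2006), §4.2.2.
-/

set_option autoImplicit false
-- the mandated namespace repeats the single-problem summit's segment (`HodgeConjecture.HodgeConjecture`), as in every `Theorems/*.lean` of this sub-problem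
set_option linter.dupNamespace false

noncomputable section

open Polynomial
open scoped Matrix MatrixGroups
open Literature.NumberTheory.Weil1982.UnitaryFinTopForm Literature.LinearAlgebra.Matrix

namespace Summit.HodgeConjecture.HodgeConjecture.Cruxes.H413.K2E3CayleyScalingAlgebra

/-! ## §1 Ring-level algebra of `c`, `c⁻¹` and conjugation -/

section Ring

variable {R : Type*} [CommRing R] {n : Type*} [Fintype n] [DecidableEq n]

/-- **`c⁻¹(c(X)) = X`**: `(c(X) − 1)(c(X) + 1)⁻¹ = X` for `2 ∈ Rˣ` and `det(1 − X) ∈ Rˣ` (★ `self_mul_cayley_add_one`: `X·(c(X) + 1) = c(X) − 1`, and `c(X) + 1 = 2(1 − X)⁻¹` is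
invertible, ★ `isUnit_det_cayley_add_one`). [cite: PlatonovRapinchuk1994, §3.3] -/
theorem inverseWindow_cayley (h2 : IsUnit (2 : R)) {X : Matrix n n R} (hm : IsUnit (1 - X).det) :
    (cayley X - 1) * (cayley X + 1)⁻¹ = X := by
  rw [← self_mul_cayley_add_one hm]
  exact Matrix.mul_nonsing_inv_cancel_right _ _ (isUnit_det_cayley_add_one h2 hm)

/-- Conjugation by a unit commutes with matrix inversion at an invertible matrix: `(x A x⁻¹)⁻¹ = x A⁻¹ x⁻¹`. [cite: PlatonovRapinchuk1994, §3.3] -/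
theorem conj_nonsing_inv (x : GL n R) {A : Matrix n n R} (hA : IsUnit A.det) :
    ((x : Matrix n n R) * A * ((x⁻¹ : GL n R) : Matrix n n R))⁻¹ = (x : Matrix n n R) * A⁻¹ * ((x⁻¹ : GL n R) : Matrix n n R) := by
  apply Matrix.inv_eq_right_inv
  have hx : ((x⁻¹ : GL n R) : Matrix n n R) * (x : Matrix n n R) = 1 := by
    rw [← Units.val_mul, inv_mul_cancel, Units.val_one]
  calc (x : Matrix n n R) * A * ((x⁻¹ : GL n R) : Matrix n n R) * ((x : Matrix n n R) * A⁻¹ * ((x⁻¹ : GL n R) : Matrix n n R))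
      = (x : Matrix n n R) * A * ((((x⁻¹ : GL n R) : Matrix n n R)) * (x : Matrix n n R)) * A⁻¹ * ((x⁻¹ : GL n R) : Matrix n n R) := by
        simp only [Matrix.mul_assoc]
    _ = 1 := by
        rw [hx, Matrix.mul_one, Matrix.mul_nonsing_inv_cancel_right _ _ hA, ← Units.val_mul, mul_inv_cancel, Units.val_one]

/-- The determinant is conjugation invariant: `det(x A x⁻¹) = det A`. [folklore] -/
theorem det_conj (x : GL n R) (A : Matrix n n R) :
    ((x : Matrix n n R) * A * ((x⁻¹ : GL n R) : Matrix n n R)).det = A.det := by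
  rw [Matrix.det_mul, Matrix.det_mul, mul_comm, ← mul_assoc, ← Matrix.det_mul, ← Units.val_mul, inv_mul_cancel, Units.val_one, Matrix.det_one, one_mul]

/-- `x (A ± 1) x⁻¹ = x A x⁻¹ ± 1` and `x (1 ± A) x⁻¹ = 1 ± x A x⁻¹`. [folklore] -/
theorem conj_add_one (x : GL n R) (A : Matrix n n R) :
    (x : Matrix n n R) * (A + 1) * ((x⁻¹ : GL n R) : Matrix n n R) = (x : Matrix n n R) * A * ((x⁻¹ : GL n R) : Matrix n n R) + 1 ∧
    (x : Matrix n n R) * (A - 1) * ((x⁻¹ : GL n R) : Matrix n n R) = (x : Matrix n n R) * A * ((x⁻¹ : GL n R) : Matrix n n R) - 1 ∧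
    (x : Matrix n n R) * (1 + A) * ((x⁻¹ : GL n R) : Matrix n n R) = 1 + (x : Matrix n n R) * A * ((x⁻¹ : GL n R) : Matrix n n R) ∧
    (x : Matrix n n R) * (1 - A) * ((x⁻¹ : GL n R) : Matrix n n R) = 1 - (x : Matrix n n R) * A * ((x⁻¹ : GL n R) : Matrix n n R) := by
  have hx : (x : Matrix n n R) * ((x⁻¹ : GL n R) : Matrix n n R) = 1 := by rw [← Units.val_mul, mul_inv_cancel, Units.val_one]
  refine ⟨?_, ?_, ?_, ?_⟩
  · rw [Matrix.mul_add, Matrix.add_mul, Matrix.mul_one, hx]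
  · rw [Matrix.mul_sub, Matrix.sub_mul, Matrix.mul_one, hx]
  · rw [Matrix.mul_add, Matrix.add_mul, Matrix.mul_one, hx]
  · rw [Matrix.mul_sub, Matrix.sub_mul, Matrix.mul_one, hx]

/-- **`c⁻¹` is conjugation-equivariant**: `c⁻¹(x g x⁻¹) = x c⁻¹(g) x⁻¹` for `g + 1` invertible. [cite: PlatonovRapinchuk1994, §3.3] -/
theorem inverseWindow_conj (x : GL n R) {g : Matrix n n R} (hP : IsUnit (g + 1).det) :
    ((x : Matrix n n R) * g * ((x⁻¹ : GL n R) : Matrix n n R) - 1) * ((x : Matrix n n R) * g * ((x⁻¹ : GL n R) : Matrix n n R) + 1)⁻¹ =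
      (x : Matrix n n R) * ((g - 1) * (g + 1)⁻¹) * ((x⁻¹ : GL n R) : Matrix n n R) := by
  obtain ⟨hadd, hsub, -, -⟩ := conj_add_one x g
  have hx : ((x⁻¹ : GL n R) : Matrix n n R) * (x : Matrix n n R) = 1 := by rw [← Units.val_mul, inv_mul_cancel, Units.val_one]
  rw [← hadd, ← hsub, conj_nonsing_inv x hP]
  calc (x : Matrix n n R) * (g - 1) * ((x⁻¹ : GL n R) : Matrix n n R) * ((x : Matrix n n R) * (g + 1)⁻¹ * ((x⁻¹ : GL n R) : Matrix n n R))
      = (x : Matrix n n R) * (g - 1) * ((((x⁻¹ : GL n R) : Matrix n n R)) * (x : Matrix n n R)) * (g + 1)⁻¹ * ((x⁻¹ : GL n R) : Matrix n n R) := by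
        simp only [Matrix.mul_assoc]
    _ = (x : Matrix n n R) * ((g - 1) * (g + 1)⁻¹) * ((x⁻¹ : GL n R) : Matrix n n R) := by
        rw [hx, Matrix.mul_one]; simp only [Matrix.mul_assoc]

/-- **`c` is conjugation-equivariant**: `c(x Y x⁻¹) = x c(Y) x⁻¹` for `det(1 − Y)` a unit. [cite: PlatonovRapinchuk1994, §3.3] -/
theorem cayley_conj (x : GL n R) {Y : Matrix n n R} (hm : IsUnit (1 - Y).det) :
    cayley ((x : Matrix n n R) * Y * ((x⁻¹ : GL n R) : Matrix n n R)) = (x : Matrix n n R) * cayley Y * ((x⁻¹ : GL n R) : Matrix n n R) := by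
  obtain ⟨-, -, hadd, hsub⟩ := conj_add_one x Y
  have hx : ((x⁻¹ : GL n R) : Matrix n n R) * (x : Matrix n n R) = 1 := by rw [← Units.val_mul, inv_mul_cancel, Units.val_one]
  rw [cayley_def, cayley_def, ← hadd, ← hsub, conj_nonsing_inv x hm]
  calc (x : Matrix n n R) * (1 + Y) * ((x⁻¹ : GL n R) : Matrix n n R) * ((x : Matrix n n R) * (1 - Y)⁻¹ * ((x⁻¹ : GL n R) : Matrix n n R))
      = (x : Matrix n n R) * (1 + Y) * ((((x⁻¹ : GL n R) : Matrix n n R)) * (x : Matrix n n R)) * (1 - Y)⁻¹ * ((x⁻¹ : GL n R) : Matrix n n R) := by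
        simp only [Matrix.mul_assoc]
    _ = (x : Matrix n n R) * ((1 + Y) * (1 - Y)⁻¹) * ((x⁻¹ : GL n R) : Matrix n n R) := by
        rw [hx, Matrix.mul_one]; simp only [Matrix.mul_assoc]

/-- `det(1 − x Y x⁻¹) = det(1 − Y)` (so the Cayley transform is defined on the whole conjugacy class of `Y`). [folklore] -/
theorem det_one_sub_conj (x : GL n R) (Y : Matrix n n R) :
    (1 - (x : Matrix n n R) * Y * ((x⁻¹ : GL n R) : Matrix n n R)).det = (1 - Y).det := by
  obtain ⟨-, -, -, hsub⟩ := conj_add_one x Y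
  rw [← hsub, det_conj]

/-- `det(x g x⁻¹ + 1) = det(g + 1)`. [folklore] -/
theorem det_conj_add_one (x : GL n R) (g : Matrix n n R) :
    ((x : Matrix n n R) * g * ((x⁻¹ : GL n R) : Matrix n n R) + 1).det = (g + 1).det := by
  obtain ⟨hadd, -, -, -⟩ := conj_add_one x g
  rw [← hadd, det_conj]

/-- **The scaled chart through `c`**: `c⁻¹(c(Y)) = Y`, so the scaling `g ↦ c(s • c⁻¹(g))` sends `c(Y)` to `c(s • Y)` — the iterate bookkeeping of `Ψ = c ∘ (t²·) ∘ c⁻¹`: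
`Ψ(c(Y)) = c(t²Y)`, `Ψ^k(c(Y)) = c(t^{2k}Y)`. [cite: PlatonovRapinchuk1994, §3.3] [cite: HarishChandra1999AdmissibleDistributions, §3.1 Lemma 3.2] -/
theorem smul_inverseWindow_cayley (h2 : IsUnit (2 : R)) (s : R) {Y : Matrix n n R} (hm : IsUnit (1 - Y).det) :
    s • ((cayley Y - 1) * (cayley Y + 1)⁻¹) = s • Y := by
  rw [inverseWindow_cayley h2 hm]

/-! ### `3 × 3`: coefficients of `χ_{t•M}` and `det(1 + M)` -/

/-- **The coefficients of `χ_{t•M}` are `t^{3−k}` times those of `χ_M`** (`3 × 3`; ★ `charpoly_coeff_fin_three`). [cite: BasuPollackRoy2006, §4.2.2] -/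
theorem charpoly_coeff_smul_fin_three (t : R) (M : Matrix (Fin 3) (Fin 3) R) :
    (t • M).charpoly.coeff 2 = t * M.charpoly.coeff 2 ∧ (t • M).charpoly.coeff 1 = t ^ 2 * M.charpoly.coeff 1 ∧
      (t • M).charpoly.coeff 0 = t ^ 3 * M.charpoly.coeff 0 := by
  obtain ⟨-, h2, h1, h0⟩ := charpoly_coeff_fin_three (t • M)
  obtain ⟨-, k2, k1, k0⟩ := charpoly_coeff_fin_three M
  rw [h2, h1, h0, k2, k1, k0]
  simp only [Matrix.smul_apply, smul_eq_mul]
  refine ⟨by ring, by ring, by ring⟩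

/-- `det(1 + M) = 1 − c₂ + c₁ − c₀` for a `3 × 3` matrix (`cₖ = χ_M.coeff k`; ★ `det_smul_one_sub_smul_fin_three` at `a = 1`, `b = −1`). [cite: BasuPollackRoy2006, §4.2.2] -/
theorem det_one_add_fin_three (M : Matrix (Fin 3) (Fin 3) R) :
    (1 + M).det = 1 - M.charpoly.coeff 2 + M.charpoly.coeff 1 - M.charpoly.coeff 0 := by
  have h := det_smul_one_sub_smul_fin_three M 1 (-1)
  rw [one_smul, neg_smul, one_smul, sub_neg_eq_add] at h
  rw [h]
  ring

end Ring

/-! ## §2 The eigenvalue ball over an ultrametric normed field: `det(1 ∓ M)` has absolute value `1`, and scaling contracts the ball -/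

section Ultrametric

variable {K : Type*} [NormedField K] [IsUltrametricDist K]

/-- `‖1 + x‖ = 1` for `‖x‖ < 1` in an ultrametric normed field. [folklore] -/
theorem norm_one_add_eq_one {x : K} (hx : ‖x‖ < 1) : ‖1 + x‖ = 1 := by
  have hne : ‖(1 : K)‖ ≠ ‖x‖ := by rw [norm_one]; exact hx.ne'
  rw [IsUltrametricDist.norm_add_eq_max_of_norm_ne_norm hne, norm_one, max_eq_left hx.le]

/-- The sum of the three «small» coefficients is small: `‖c₂‖ ≤ ρ`, `‖c₁‖ ≤ ρ²`, `‖c₀‖ ≤ ρ³`, `ρ < 1` ⇒ `‖±c₂ + c₁ ± c₀‖ ≤ ρ < 1`. [folklore] -/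
theorem norm_coeff_sum_le {c₂ c₁ c₀ : K} {ρ : ℝ} (hρ : ρ < 1) (h2 : ‖c₂‖ ≤ ρ) (h1 : ‖c₁‖ ≤ ρ ^ 2) (h0 : ‖c₀‖ ≤ ρ ^ 3) :
    ‖c₂ + c₁ + c₀‖ ≤ ρ ∧ ‖-c₂ + c₁ - c₀‖ ≤ ρ := by
  have hρ0 : 0 ≤ ρ := (norm_nonneg _).trans h2
  have hρ2 : ρ ^ 2 ≤ ρ := by nlinarith
  have hρ3 : ρ ^ 3 ≤ ρ := by nlinarith
  have h1' : ‖c₁‖ ≤ ρ := h1.trans hρ2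
  have h0' : ‖c₀‖ ≤ ρ := h0.trans hρ3
  constructor
  · calc ‖c₂ + c₁ + c₀‖ ≤ max ‖c₂ + c₁‖ ‖c₀‖ := IsUltrametricDist.norm_add_le_max _ _
      _ ≤ max (max ‖c₂‖ ‖c₁‖) ‖c₀‖ := max_le_max (IsUltrametricDist.norm_add_le_max _ _) le_rfl
      _ ≤ ρ := max_le (max_le h2 h1') h0'
  · calc ‖-c₂ + c₁ - c₀‖ ≤ max ‖-c₂ + c₁‖ ‖c₀‖ := by rw [sub_eq_add_neg]; exact (IsUltrametricDist.norm_add_le_max _ _).trans (by rw [norm_neg])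
      _ ≤ max (max ‖-c₂‖ ‖c₁‖) ‖c₀‖ := max_le_max (IsUltrametricDist.norm_add_le_max _ _) le_rfl
      _ ≤ ρ := max_le (max_le (by rw [norm_neg]; exact h2) h1') h0'

/-- **`‖det(1 − M)‖ = 1` on the eigenvalue ball** (`det(1 − M) = 1 + c₂ + c₁ + c₀`, ★ `det_one_sub_fin_three`). [cite: PlatonovRapinchuk1994, §3.3] -/
theorem norm_det_one_sub_eq_one {M : Matrix (Fin 3) (Fin 3) K} {ρ : ℝ} (hρ : ρ < 1) (h2 : ‖M.charpoly.coeff 2‖ ≤ ρ)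
    (h1 : ‖M.charpoly.coeff 1‖ ≤ ρ ^ 2) (h0 : ‖M.charpoly.coeff 0‖ ≤ ρ ^ 3) : ‖(1 - M).det‖ = 1 := by
  rw [det_one_sub_fin_three, add_assoc, add_assoc, ← add_assoc (M.charpoly.coeff 2)]
  exact norm_one_add_eq_one ((norm_coeff_sum_le hρ h2 h1 h0).1.trans_lt hρ)

/-- **`‖det(1 + M)‖ = 1` on the eigenvalue ball** (`det(1 + M) = 1 − c₂ + c₁ − c₀`). [cite: PlatonovRapinchuk1994, §3.3] -/
theorem norm_det_one_add_eq_one {M : Matrix (Fin 3) (Fin 3) K} {ρ : ℝ} (hρ : ρ < 1) (h2 : ‖M.charpoly.coeff 2‖ ≤ ρ)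
    (h1 : ‖M.charpoly.coeff 1‖ ≤ ρ ^ 2) (h0 : ‖M.charpoly.coeff 0‖ ≤ ρ ^ 3) : ‖(1 + M).det‖ = 1 := by
  have h : (1 + M).det = 1 + (-M.charpoly.coeff 2 + M.charpoly.coeff 1 - M.charpoly.coeff 0) := by rw [det_one_add_fin_three]; ring
  rw [h]
  exact norm_one_add_eq_one ((norm_coeff_sum_le hρ h2 h1 h0).2.trans_lt hρ)

/-- On the eigenvalue ball `det(1 − M)` and `det(1 + M)` are units (absolute value `1`). [cite: PlatonovRapinchuk1994, §3.3] -/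
theorem isUnit_det_one_sub_add_of_ball {M : Matrix (Fin 3) (Fin 3) K} {ρ : ℝ} (hρ : ρ < 1) (h2 : ‖M.charpoly.coeff 2‖ ≤ ρ)
    (h1 : ‖M.charpoly.coeff 1‖ ≤ ρ ^ 2) (h0 : ‖M.charpoly.coeff 0‖ ≤ ρ ^ 3) : IsUnit (1 - M).det ∧ IsUnit (1 + M).det := by
  constructor
  · exact isUnit_iff_ne_zero.2 fun h => by have := norm_det_one_sub_eq_one hρ h2 h1 h0; rw [h, norm_zero] at this; exact zero_ne_one this
  · exact isUnit_iff_ne_zero.2 fun h => by have := norm_det_one_add_eq_one hρ h2 h1 h0; rw [h, norm_zero] at this; exact zero_ne_one this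

omit [IsUltrametricDist K] in
/-- **Scaling contracts the eigenvalue ball**: the coefficients of `χ_{t•M}` satisfy the bounds with `‖t‖·ρ` in place of `ρ` (`cₖ(t•M) = t^{3−k} cₖ(M)`); in particular
`t•M` stays in the `ρ`-ball for `‖t‖ ≤ 1`. [cite: HarishChandra1999AdmissibleDistributions, §3.1 Lemma 3.2] -/
theorem coeff_ball_smul (t : K) {M : Matrix (Fin 3) (Fin 3) K} {ρ : ℝ} (h2 : ‖M.charpoly.coeff 2‖ ≤ ρ)
    (h1 : ‖M.charpoly.coeff 1‖ ≤ ρ ^ 2) (h0 : ‖M.charpoly.coeff 0‖ ≤ ρ ^ 3) :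
    ‖(t • M).charpoly.coeff 2‖ ≤ ‖t‖ * ρ ∧ ‖(t • M).charpoly.coeff 1‖ ≤ (‖t‖ * ρ) ^ 2 ∧ ‖(t • M).charpoly.coeff 0‖ ≤ (‖t‖ * ρ) ^ 3 := by
  obtain ⟨e2, e1, e0⟩ := charpoly_coeff_smul_fin_three t M
  rw [e2, e1, e0, norm_mul, norm_mul, norm_mul, norm_pow, norm_pow, mul_pow, mul_pow]
  exact ⟨mul_le_mul_of_nonneg_left h2 (norm_nonneg _), mul_le_mul_of_nonneg_left h1 (pow_nonneg (norm_nonneg _) _),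
    mul_le_mul_of_nonneg_left h0 (pow_nonneg (norm_nonneg _) _)⟩

omit [IsUltrametricDist K] in
/-- The contracted ball lies in the original one when `‖t‖ ≤ 1`. [cite: HarishChandra1999AdmissibleDistributions, §3.1 Lemma 3.2] -/
theorem coeff_ball_smul_of_norm_le_one {t : K} (ht : ‖t‖ ≤ 1) {M : Matrix (Fin 3) (Fin 3) K} {ρ : ℝ} (h2 : ‖M.charpoly.coeff 2‖ ≤ ρ)
    (h1 : ‖M.charpoly.coeff 1‖ ≤ ρ ^ 2) (h0 : ‖M.charpoly.coeff 0‖ ≤ ρ ^ 3) :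
    ‖(t • M).charpoly.coeff 2‖ ≤ ρ ∧ ‖(t • M).charpoly.coeff 1‖ ≤ ρ ^ 2 ∧ ‖(t • M).charpoly.coeff 0‖ ≤ ρ ^ 3 := by
  have hρ0 : 0 ≤ ρ := (norm_nonneg _).trans h2
  have htρ : ‖t‖ * ρ ≤ ρ := by nlinarith [norm_nonneg t]
  have htρ0 : 0 ≤ ‖t‖ * ρ := mul_nonneg (norm_nonneg _) hρ0
  obtain ⟨e2, e1, e0⟩ := coeff_ball_smul t h2 h1 h0
  exact ⟨e2.trans htρ, e1.trans (pow_le_pow_left₀ htρ0 htρ 2), e0.trans (pow_le_pow_left₀ htρ0 htρ 3)⟩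

end Ultrametric

end Summit.HodgeConjecture.HodgeConjecture.Cruxes.H413.K2E3CayleyScalingAlgebra

end
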